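import Literature.NumberTheory.Transcendental.L2HodgeTheory
import Literature.NumberTheory.Transcendental.FormIntegrationFlat
import Literature.Geometry.Kaehler.HodgeStarConstOneProofs
import Literature.Geometry.Kaehler.HodgeStarOfVolumeFormProofs
import Mathlib.Geometry.Manifold.Riemannian.Basic
import Mathlib.Analysis.Calculus.BumpFunction.InnerProduct
import Mathlib.Analysis.Calculus.ContDiff.Deriv
import HarnessLib

/-!
# The named fact `l2Inner_hodgeLaplacian_comm` is false as stated (the flat real line)

`L2HodgeTheory.lean` records Warner's Corollary to Prop. 6.2, "`Δ` is self-adjoint,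
`⟨Δα, β⟩ = ⟨α, Δβ⟩ (α, β ∈ E^p(M))`" (GTM 94, p. 221; "throughout this chapter, `M` will be a
compact oriented Riemannian manifold", p. 220) as the named fact `l2Inner_hodgeLaplacian_comm o`.
That `def … : Prop` was written after `variable [CompactSpace M] [I.Boundaryless]
[IsContinuousRiemannianBundle …] [IsContMDiffRiemannianBundle I ∞ …]`, but its body uses none of
these section instances, so they were *not* abstracted: as elaborated the fact quantifies over
every Hausdorff σ-compact `C^∞` manifold, compact or not. This file proves that in that generality
it is **false** (`FlatLine.not_l2Inner_hodgeLaplacian_comm_real`, and the closure form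
`not_forall_l2Inner_hodgeLaplacian_comm`): it fails for the real line with Mathlib's canonical
flat Riemannian structure (`riemannianMetricVectorSpace`) and the standard orientation. The
correctly hypothesised statement and its proof are `l2Inner_hodgeLaplacian_comm_of_isSmoothForm` /
`l2Inner_hodgeLaplacian_comm_of_isClosedManifold(_holds)` in `L2HodgeTheoryLaplacianProofs.lean`.

## The counterexample (`namespace FlatLine`)

On `M = ℝ` (`𝓘(ℝ, ℝ)`, `n = 1`, `k = 0`, `m = 1`; orientation of the basis `1`, volume form
`vol(v) = v`, constant hence smooth) take the smooth `0`-forms `α = 1` and `β = g` with `g'' = φ`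
a smooth bump, `φ ≥ 0`, `φ(0) = 1` (two primitives of Mathlib's `ContDiffBump`). In dimension one
`df = f' vol` (`extDeriv_constOfIsEmpty` in the identity chart) and `⋆(c vol) = c`
(`hodgeStar_volumeFormL_holds`), so `δdf = -⋆d⋆df = -f''` and `Δf = -f''` at every point (no junk
values). Hence `Δα = 0`, `⟪Δα, β⟫ = 0`, while `⟪α, Δβ⟫ = ∫_ℝ (-φ) vol`: a *compactly supported*
continuous multiple of `vol`, for which the partition-of-unity `finsum` defining `MForm.integral`
is an honest finite sum of Lebesgue integrals — identity charts, constant non-zero chart sign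
`sign o₀(e)`, only the finitely many `ρᵢ` with `supp ρᵢ ∩ supp φ ≠ ∅` contribute (local
finiteness), and `∑ᵢ ρᵢ = 1` — giving `∫_ℝ f vol = sign o₀(e) · e · ∫ f dλ_e`
(`e = modelBasis ℝ 1 0 ≠ 0`, `λ_e` its Haar measure). As `∫ φ dλ_e > 0`, `⟪α, Δβ⟫ ≠ 0`.

## References

* F. W. Warner, *Foundations of Differentiable Manifolds and Lie Groups*, GTM 94 (1983), 6.1 and
  Prop. 6.2 with its Corollary (5), pp. 220–221 — the intended (compact) statement.

## Verdict clean-up note (2026-08-15)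

The named fact `l2Inner_hodgeLaplacian_comm` is now an `@[deprecated]` record of
`L2HodgeTheory.lean` (mis-stated, resp. refuted as stated: a `def` does not abstract the unused
section instances it was written under; the corrected statements are the ones proved or named in
this file and in the records' docstrings). The declarations `not_l2Inner_hodgeLaplacian_comm_real`,
`not_forall_l2Inner_hodgeLaplacian_comm` name the record on purpose, so `linter.deprecated` is
silenced on exactly those declarations (REMOVE-WHEN the records are deleted from
`L2HodgeTheory.lean`).
-/

noncomputable section
noncomputable section

open scoped Manifold ContDiff Topology InnerProductSpace
open Bundle Module Set Function MeasureTheory ContinuousAlternatingMap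
open Literature.Geometry.Kaehler

namespace Literature.NumberTheory.Transcendental

namespace FlatLine

/-- `finrank ℝ ℝ = 1`, the `Fact` consumed by `Orientation.volumeForm` and the Hodge star (a local
instance below, never a global one). [folklore] -/
theorem factFinrank : Fact (finrank ℝ ℝ = 1) := ⟨Module.finrank_self ℝ⟩

attribute [local instance] factFinrank

/-! ### The flat line: metric, orientation, volume form -/

/-- The inner product of Mathlib's flat Riemannian structure on `T_x ℝ = ℝ`
(`riemannianMetricVectorSpace`) is multiplication. [folklore] -/
theorem inner_eq (x : ℝ) (u v : TangentSpace 𝓘(ℝ, ℝ) x) :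
    ⟪u, v⟫_ℝ = (show ℝ from u) * (show ℝ from v) := by
  change ⟪(show ℝ from u), (show ℝ from v)⟫_ℝ = _
  simp [mul_comm]

/-- The basis `1` of `T_x ℝ`. [folklore] -/
def basisOne (x : ℝ) : Basis (Fin 1) ℝ (TangentSpace 𝓘(ℝ, ℝ) x) := Basis.singleton (Fin 1) ℝ

/-- The basis `1` of `T_x ℝ` is orthonormal for the flat metric. [folklore] -/
theorem basisOne_orthonormal (x : ℝ) : Orthonormal ℝ (basisOne x) := by
  rw [orthonormal_iff_ite]
  intro i j
  rw [Subsingleton.elim i j, inner_eq, if_pos rfl]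
  change (Basis.singleton (Fin 1) ℝ j) * (Basis.singleton (Fin 1) ℝ j) = 1
  simp

/-- The orthonormal basis `1` of `T_x ℝ`. [folklore] -/
def onb (x : ℝ) : OrthonormalBasis (Fin 1) ℝ (TangentSpace 𝓘(ℝ, ℝ) x) :=
  (basisOne x).toOrthonormalBasis (basisOne_orthonormal x)

/-- The standard orientation of `ℝ` (the orientation of the basis `1`). [folklore] -/
def o₀ : Orientation ℝ ℝ (Fin 1) := (Basis.singleton (Fin 1) ℝ).orientation

/-- The standard orientation of `ℝ` on every tangent space (a *constant* family). [folklore] -/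
def orient (x : ℝ) : Orientation ℝ (TangentSpace 𝓘(ℝ, ℝ) x) (Fin 1) := o₀

/-- **The volume form of the flat line is `dx`**: `vol(v) = v` (`Orientation.volumeForm_robust`
in the positively oriented orthonormal basis `1`). [folklore] -/
theorem volumeForm_apply (x : ℝ) (v : Fin 1 → TangentSpace 𝓘(ℝ, ℝ) x) :
    (orient x).volumeForm v = (show ℝ from v 0) := by
  have hb : (onb x).toBasis = basisOne x := Basis.toBasis_toOrthonormalBasis _ _
  rw [Orientation.volumeForm_robust _ (onb x) (by rw [hb]; rfl), hb, Basis.det_apply,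
    Matrix.det_unique, Basis.toMatrix_apply]
  change (Basis.singleton (Fin 1) ℝ).repr (show ℝ from v default) default = _
  rw [Basis.singleton_repr]
  rfl

/-- The Riemannian volume form of the flat line evaluates as `vol(v) = v`. [folklore] -/
theorem vol_apply (x : ℝ) (v : Fin 1 → TangentSpace 𝓘(ℝ, ℝ) x) :
    riemannianVolumeForm orient x v = (show ℝ from v 0) := by
  rw [riemannianVolumeForm_apply, Orientation.volumeFormL_apply, volumeForm_apply]

/-- `(c vol)(v) = c v`. [folklore] -/
theorem smul_vol_apply (c y : ℝ) (v : Fin 1 → TangentSpace 𝓘(ℝ, ℝ) y) :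
    (c • riemannianVolumeForm orient y) v = c * (show ℝ from v 0) := by
  rw [ContinuousAlternatingMap.smul_apply, vol_apply, smul_eq_mul]

/-- The Riemannian volume form of the flat line is constant (definitionally). [folklore] -/
theorem riemannianVolumeForm_const (x : ℝ) :
    riemannianVolumeForm orient x = riemannianVolumeForm orient 0 := rfl

/-- On the model space `ℝ` the chart representative of a form is the form itself (all charts are
the identity; cf. `mextDeriv_eq_extDeriv`). [folklore] -/
theorem inChart_eq_self {k : ℕ} (α : MForm 𝓘(ℝ, ℝ) ℝ ℝ k) (x₀ : ℝ) : α.inChart x₀ = α := by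
  funext y
  ext
  simp [MForm.inChart_apply]
  rfl

/-- The (constant) volume form of the flat line is smooth: the hypothesis `ho` of the fact holds
for `orient`. [folklore] -/
theorem isSmoothForm_riemannianVolumeForm : IsSmoothForm (riemannianVolumeForm orient) := by
  intro x
  rw [inChart_eq_self, funext riemannianVolumeForm_const]
  exact contDiffWithinAt_const

/-! ### `0`-forms and their Laplacian `Δf = -f''` -/

/-- The `0`-form on `ℝ` attached to a function `f`. [folklore] -/
def zeroForm (f : ℝ → ℝ) : MForm 𝓘(ℝ, ℝ) ℝ ℝ 0 := fun x ↦ constOfIsEmpty ℝ ℝ (Fin 0) (f x)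

/-- The `0`-form of a `C^∞` function is smooth. [folklore] -/
theorem isSmoothForm_zeroForm {f : ℝ → ℝ} (hf : ContDiff ℝ ∞ f) : IsSmoothForm (zeroForm f) := by
  intro x
  rw [inChart_eq_self]
  exact ((constOfIsEmptyLIE ℝ ℝ ℝ (Fin 0)).contDiff.comp hf).contDiffWithinAt

/-- The `0`-form of the zero function is `0`. [folklore] -/
theorem zeroForm_zero : zeroForm (fun _ ↦ 0) = 0 := by
  funext x; ext; rfl

/-- `zeroForm (-f) = -zeroForm f`. [folklore] -/
theorem zeroForm_neg (f : ℝ → ℝ) : zeroForm (fun x ↦ -f x) = -zeroForm f := by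
  funext x; ext; rfl

/-- **`df = f' vol`** at every point of the flat line (`extDeriv_constOfIsEmpty` in the identity
chart, `mextDeriv_eq_extDeriv`, `toSpanSingleton_deriv`). [folklore] -/
theorem mextDeriv_zeroForm (f : ℝ → ℝ) (x : ℝ) :
    mextDeriv (zeroForm f) x = deriv f x • riemannianVolumeForm orient x := by
  refine ContinuousAlternatingMap.ext fun v ↦ ?_
  rw [ContinuousAlternatingMap.smul_apply, vol_apply, mextDeriv_eq_extDeriv,
    show zeroForm f = fun y ↦ constOfIsEmpty ℝ ℝ (Fin 0) (f y) from rfl, extDeriv_constOfIsEmpty]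
  change fderiv ℝ f x (show ℝ from v 0) = deriv f x • (show ℝ from v 0)
  rw [← toSpanSingleton_deriv, ContinuousLinearMap.toSpanSingleton_apply, smul_eq_mul, smul_eq_mul,
    mul_comm]

/-- `c • 1 = c` for constant `0`-forms on `T_x ℝ`. [folklore] -/
theorem smul_constOfIsEmpty_one (x : ℝ) (c : ℝ) :
    c • constOfIsEmpty ℝ (TangentSpace 𝓘(ℝ, ℝ) x) (Fin 0) (1 : ℝ) =
      constOfIsEmpty ℝ (TangentSpace 𝓘(ℝ, ℝ) x) (Fin 0) c :=
  ContinuousAlternatingMap.ext fun v ↦ by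
    rw [ContinuousAlternatingMap.smul_apply, constOfIsEmpty_apply, constOfIsEmpty_apply, smul_eq_mul,
      mul_one]

/-- **`⋆(c vol) = c`** on `T_x ℝ` (the discharged `hodgeStar_volumeFormL_holds : ⋆vol = 1`).
[folklore] -/
theorem hodgeStar_smul_vol (h : 1 + 0 = 1) (x : ℝ) (c : ℝ) :
    hodgeStar (orient x) h (c • riemannianVolumeForm orient x) =
      constOfIsEmpty ℝ (TangentSpace 𝓘(ℝ, ℝ) x) (Fin 0) c := by
  rw [map_smul, riemannianVolumeForm_apply, hodgeStar_volumeFormL_holds (orient x) h,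
    smul_constOfIsEmpty_one]

/-- **`⋆df = f'`** as `0`-forms on the flat line. [folklore] -/
theorem hodgeStar_mextDeriv_zeroForm (h : 0 + 1 + 0 = 1) (f : ℝ → ℝ) :
    MForm.hodgeStar orient h (mextDeriv (zeroForm f)) = zeroForm (deriv f) := by
  funext x
  rw [MForm.hodgeStar_apply, mextDeriv_zeroForm, hodgeStar_smul_vol]
  rfl

/-- **`δ d f = -f''`** on the flat line: `δ = (-1)^{n·k+1} ⋆d⋆ = -⋆d⋆` on `1`-forms (`n = 1`,
`k = 0`), and `⋆d⋆df = ⋆d(f') = f''`. [folklore] -/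
theorem mcoderiv_mextDeriv_zeroForm (h : 0 + 1 + 0 = 1) (f : ℝ → ℝ) :
    mcoderiv orient h (mextDeriv (zeroForm f)) = zeroForm (fun x ↦ -(deriv (deriv f) x)) := by
  rw [mcoderiv, hodgeStar_mextDeriv_zeroForm, hodgeStar_mextDeriv_zeroForm, zeroForm_neg]
  norm_num

/-- **`Δf = -f''`** on `0`-forms of the flat line (`Δ = δd` in the degree pattern `(0, m + 1)` of
`hodgeLaplacian`), for every `f` — Warner's "on `E⁰(ℝⁿ)`, `Δ = (-1) ∑ ∂²/∂xᵢ²`" (6.1, p. 220). [folklore] -/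
theorem hodgeLaplacian_zeroForm (h : 0 + 1 = 1) (f : ℝ → ℝ) :
    hodgeLaplacian orient 0 1 h (zeroForm f) = zeroForm (fun x ↦ -(deriv (deriv f) x)) :=
  mcoderiv_mextDeriv_zeroForm _ f

/-- The pointwise inner product of `0`-forms is the product of their values (the sum in
`alternatingFormInner` has the single empty multi-index). [folklore] -/
theorem inner_zeroForm (f₁ f₂ : ℝ → ℝ) (x : ℝ) :
    MForm.inner 1 (zeroForm f₁) (zeroForm f₂) x = f₁ x * f₂ x := by
  haveI := HodgeStarAux.subsingleton_powersetCard_zero (Fin 1)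
  rw [MForm.inner, alternatingFormInner_apply, Fintype.sum_subsingleton _
    (Set.powersetCard.ofCard Finset.card_empty : Set.powersetCard (Fin 1) 0)]
  rfl

/-! ### The integral of a compactly supported multiple of `vol` over `ℝ` -/

/-- The extended charts of `ℝ` are the identity. [folklore] -/
theorem extChartAt_eq (x : ℝ) : extChartAt 𝓘(ℝ, ℝ) x = PartialEquiv.refl ℝ := by
  simp

/-- The chart signs of the constant orientation family `orient` are the constant `sign o₀(e)`,
`e = modelBasis ℝ 1` (identity charts). [folklore] -/
theorem chartSign_eq (i y : ℝ) :
    chartSign orient i y = Real.sign (o₀.someVector (modelBasis ℝ 1)) := by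
  simp [chartSign, orient]
  rfl

/-- A tuple of reals read as tangent vectors at `y` (the identification `T_y ℝ = ℝ`). [folklore] -/
abbrev toT (y : ℝ) {k : ℕ} (v : Fin k → ℝ) : Fin k → TangentSpace 𝓘(ℝ, ℝ) y := v

/-- The (constant) chart sign of the identity charts of `ℝ` for `o₀`. [folklore] -/
def sgn : ℝ := Real.sign (o₀.someVector (modelBasis ℝ 1))

/-- The reference basis vector `e = modelBasis ℝ 1 0` of the model space `ℝ`. [folklore] -/
def r₀ : ℝ := modelBasis ℝ 1 0

/-- `sign o₀(e) ≠ 0` (a representative of an orientation is a non-zero top form). [folklore] -/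
theorem sgn_ne_zero : sgn ≠ 0 := by
  intro h
  rw [sgn, Real.sign_eq_zero_iff] at h
  have hψ : (o₀.someVector : ℝ [⋀^Fin 1]→ₗ[ℝ] ℝ) = 0 := by
    rw [AlternatingMap.eq_smul_basis_det (modelBasis ℝ 1) o₀.someVector, h, zero_smul]
  exact Module.Ray.someVector_ne_zero o₀ hψ

/-- `e ≠ 0`. [folklore] -/
theorem r₀_ne_zero : r₀ ≠ 0 := (modelBasis ℝ 1).ne_zero 0

/-- **Unfolding `∫_ℝ f vol`** (identity charts, constant chart sign, `vol(e) = e`): the `finsum`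
over the chosen partition of unity `ρ` of the Lebesgue integrals `∫ sgn · ρᵢ · f · e dλ_e`
(no hypothesis on `f`). [folklore] -/
theorem integral_smul_vol_eq (f : ℝ → ℝ) :
    MForm.integral orient (fun x ↦ f x • riemannianVolumeForm orient x) =
      ∑ᶠ i : ℝ, ∫ y, sgn * chartPartitionOfUnity 𝓘(ℝ, ℝ) ℝ i y * (f y * r₀)
        ∂(modelBasis ℝ 1).addHaar := by
  simp only [MForm.integral, MForm.integralPU, extChartAt_eq, PartialEquiv.refl_target,
    Measure.restrict_univ, PartialEquiv.refl_symm, PartialEquiv.refl_coe, id_eq, chartSign_eq,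
    inChart_eq_self, sgn, r₀]
  congr 1 with i
  congr 1 with y
  change _ * _ * (f y • riemannianVolumeForm orient y) (toT y (modelBasis ℝ 1)) = _
  rw [smul_vol_apply]

/-- **`∫_ℝ f vol = sgn · e · ∫ f dλ_e` for `f` continuous with compact support**: only the
finitely many `i` with `supp ρᵢ ∩ supp f ≠ ∅` contribute (`LocallyFinite.finite_nonempty_inter_compact`),
each summand is a genuine integral, and `∑ᵢ ρᵢ = 1` on `supp f` (`SmoothPartitionOfUnity.sum_eq_one`).
[folklore] -/
theorem integral_smul_vol_of_hasCompactSupport {f : ℝ → ℝ} (hf : Continuous f)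
    (hfs : HasCompactSupport f) :
    MForm.integral orient (fun x ↦ f x • riemannianVolumeForm orient x) =
      sgn * r₀ * ∫ y, f y ∂(modelBasis ℝ 1).addHaar := by
  have hfin : {i | (support (chartPartitionOfUnity 𝓘(ℝ, ℝ) ℝ i) ∩ tsupport f).Nonempty}.Finite :=
    (chartPartitionOfUnity 𝓘(ℝ, ℝ) ℝ).locallyFinite.finite_nonempty_inter_compact hfs
  -- `ρ i * f` vanishes identically for `i` outside the finite set
  have hzero : ∀ i, i ∉ hfin.toFinset → ∀ y, chartPartitionOfUnity 𝓘(ℝ, ℝ) ℝ i y * f y = 0 := by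
    intro i hi y
    by_cases hy : y ∈ tsupport f
    · have h0 : chartPartitionOfUnity 𝓘(ℝ, ℝ) ℝ i y = 0 := by
        by_contra h
        exact hi (hfin.mem_toFinset.2 ⟨y, mem_support.2 h, hy⟩)
      rw [h0, zero_mul]
    · rw [image_eq_zero_of_notMem_tsupport hy, mul_zero]
  -- on the finite set the partition of unity sums to `1` wherever `f ≠ 0`
  have hone : ∀ y, f y ≠ 0 → ∑ i ∈ hfin.toFinset, chartPartitionOfUnity 𝓘(ℝ, ℝ) ℝ i y = 1 := by
    intro y hy
    have hyK : y ∈ tsupport f := subset_tsupport _ (mem_support.2 hy)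
    rw [← (chartPartitionOfUnity 𝓘(ℝ, ℝ) ℝ).sum_eq_one (mem_univ y)]
    refine (finsum_eq_sum_of_support_subset _ fun i hi ↦ ?_).symm
    exact hfin.mem_toFinset.2 ⟨y, hi, hyK⟩
  have hpt : ∀ y, ∑ i ∈ hfin.toFinset, sgn * chartPartitionOfUnity 𝓘(ℝ, ℝ) ℝ i y * (f y * r₀) =
      sgn * r₀ * f y := by
    intro y
    have h1 : ∑ i ∈ hfin.toFinset, sgn * chartPartitionOfUnity 𝓘(ℝ, ℝ) ℝ i y * (f y * r₀) =
        (sgn * r₀ * f y) * ∑ i ∈ hfin.toFinset, chartPartitionOfUnity 𝓘(ℝ, ℝ) ℝ i y := by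
      rw [Finset.mul_sum]
      exact Finset.sum_congr rfl fun i _ ↦ by ring
    rw [h1]
    by_cases hy : f y = 0
    · rw [hy]; ring
    · rw [hone y hy, mul_one]
  have hint : ∀ i ∈ hfin.toFinset, Integrable
      (fun y ↦ sgn * chartPartitionOfUnity 𝓘(ℝ, ℝ) ℝ i y * (f y * r₀)) (modelBasis ℝ 1).addHaar := by
    intro i _
    refine Continuous.integrable_of_hasCompactSupport ?_ ?_
    · exact (continuous_const.mul
        (ContMDiffMap.contMDiff (chartPartitionOfUnity 𝓘(ℝ, ℝ) ℝ i)).continuous).mul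
        (hf.mul continuous_const)
    · exact (hfs.mul_right (f' := fun _ ↦ r₀)).mul_left
  rw [integral_smul_vol_eq, finsum_eq_sum_of_support_subset _ (s := hfin.toFinset)]
  · rw [← integral_finsetSum hfin.toFinset hint]
    simp_rw [hpt]
    exact integral_const_mul _ _
  · intro i hi
    by_contra hiS
    apply hi
    have : (fun y ↦ sgn * chartPartitionOfUnity 𝓘(ℝ, ℝ) ℝ i y * (f y * r₀)) = fun _ ↦ 0 := by
      funext y
      rw [show sgn * chartPartitionOfUnity 𝓘(ℝ, ℝ) ℝ i y * (f y * r₀) =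
          sgn * r₀ * (chartPartitionOfUnity 𝓘(ℝ, ℝ) ℝ i y * f y) by ring, hzero i hiS y, mul_zero]
    show ∫ y, sgn * chartPartitionOfUnity 𝓘(ℝ, ℝ) ℝ i y * (f y * r₀) ∂(modelBasis ℝ 1).addHaar = 0
    rw [this, integral_zero]

/-- **Positivity**: a continuous compactly supported density `f ≥ 0`, `f ≢ 0`, has non-zero integral
against `vol` over the flat line (`∫ f dλ_e > 0`, `sgn ≠ 0`, `e ≠ 0`). [folklore] -/
theorem integral_smul_vol_ne_zero {f : ℝ → ℝ} (hf : Continuous f) (hfs : HasCompactSupport f)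
    (h0 : 0 ≤ f) {x₀ : ℝ} (hx : f x₀ ≠ 0) :
    MForm.integral orient (fun x ↦ f x • riemannianVolumeForm orient x) ≠ 0 := by
  rw [integral_smul_vol_of_hasCompactSupport hf hfs]
  refine mul_ne_zero (mul_ne_zero sgn_ne_zero r₀_ne_zero) (ne_of_gt ?_)
  exact integral_pos_of_integrable_nonneg_nonzero hf (hf.integrable_of_hasCompactSupport hfs) h0 hx

/-! ### A smooth function `g` with `g'' = φ` a bump -/

/-- A smooth bump `φ` at `0` (`φ ≥ 0`, `φ = 1` on `[-1, 1]`, supported in `[-2, 2]`). [folklore] -/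
def φ : ContDiffBump (0 : ℝ) := ⟨1, 2, one_pos, one_lt_two⟩

/-- `g₁(t) = ∫_{-∞}^t φ`, a primitive of the bump. [folklore] -/
def g₁ (t : ℝ) : ℝ := ∫ u in Iic t, φ u

/-- `g(x) = ∫₀ˣ g₁`, a second primitive of the bump. [folklore] -/
def g (x : ℝ) : ℝ := ∫ t in (0 : ℝ)..x, g₁ t

/-- `g₁' = φ` (fundamental theorem of calculus, `FlatPoincare.hasDerivAt_setIntegral_Iic`).
[folklore] -/
theorem hasDerivAt_g₁ (t : ℝ) : HasDerivAt g₁ (φ t) t :=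
  FlatPoincare.hasDerivAt_setIntegral_Iic φ.continuous φ.hasCompactSupport t

/-- `deriv g₁ = φ`. [folklore] -/
theorem deriv_g₁ : deriv g₁ = φ := funext fun t ↦ (hasDerivAt_g₁ t).deriv

/-- `g₁` is `C^∞` (its derivative `φ` is). [folklore] -/
theorem g₁_contDiff : ContDiff ℝ ∞ g₁ :=
  contDiff_infty_iff_deriv.2 ⟨fun t ↦ (hasDerivAt_g₁ t).differentiableAt, by
    rw [deriv_g₁]; exact φ.contDiff⟩

/-- `g' = g₁` (fundamental theorem of calculus). [folklore] -/
theorem hasDerivAt_g (x : ℝ) : HasDerivAt g (g₁ x) x :=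
  intervalIntegral.integral_hasDerivAt_right (g₁_contDiff.continuous.intervalIntegrable _ _)
    (g₁_contDiff.continuous.stronglyMeasurableAtFilter _ _) g₁_contDiff.continuous.continuousAt

/-- `deriv g = g₁`. [folklore] -/
theorem deriv_g : deriv g = g₁ := funext fun x ↦ (hasDerivAt_g x).deriv

/-- `g` is `C^∞`. [folklore] -/
theorem g_contDiff : ContDiff ℝ ∞ g :=
  contDiff_infty_iff_deriv.2 ⟨fun x ↦ (hasDerivAt_g x).differentiableAt, by
    rw [deriv_g]; exact g₁_contDiff⟩

/-- `g'' = φ`. [folklore] -/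
theorem deriv_deriv_g : deriv (deriv g) = φ := by rw [deriv_g, deriv_g₁]

/-! ### The refutation -/

/-- `⟪0, β⟫_{L²} = 0` (from `MForm.l2Inner_smul_left` with the scalar `0`). [folklore] -/
theorem l2Inner_zero_left (β : MForm 𝓘(ℝ, ℝ) ℝ ℝ 0) : MForm.l2Inner orient 0 β = 0 := by
  simpa using MForm.l2Inner_smul_left orient (0 : ℝ) (0 : MForm 𝓘(ℝ, ℝ) ℝ ℝ 0) β

-- names the `@[deprecated]` record `l2Inner_hodgeLaplacian_comm` on purpose (verdict clean-up 2026-08-15); REMOVE-WHEN the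
-- record is deleted from `L2HodgeTheory.lean`
set_option linter.deprecated false in
/-- **The named fact `l2Inner_hodgeLaplacian_comm` is false as stated.** For the flat real line
(`M = ℝ`, `𝓘(ℝ, ℝ)`, Mathlib's canonical Riemannian structure, standard orientation, `n = 1`, `k = 0`,
`m = 1`) and the smooth `0`-forms `α = 1`, `β = g` (`g'' = φ ≥ 0` a bump, `φ(0) = 1`): `Δα = 0`, so
`⟪Δα, β⟫_{L²} = 0`, whereas `⟪α, Δβ⟫_{L²} = ∫_ℝ (-φ) vol = -sgn · e · ∫ φ dλ_e ≠ 0`. The intended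
(compact) statement, Warner (1983), Prop. 6.2, Corollary, p. 221, is
`l2Inner_hodgeLaplacian_comm_of_isSmoothForm` (`L2HodgeTheoryLaplacianProofs.lean`). [folklore] -/
theorem not_l2Inner_hodgeLaplacian_comm_real :
    ¬ l2Inner_hodgeLaplacian_comm (I := 𝓘(ℝ, ℝ)) (M := ℝ) (k := 0) (m := 1) orient := by
  intro H
  have h := H isSmoothForm_riemannianVolumeForm (show 0 + 1 = 1 by norm_num)
    (isSmoothForm_zeroForm (f := fun _ ↦ (1 : ℝ)) contDiff_const) (isSmoothForm_zeroForm g_contDiff)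
  rw [hodgeLaplacian_zeroForm, hodgeLaplacian_zeroForm, deriv_deriv_g] at h
  have h1 : (fun x : ℝ ↦ -deriv (deriv fun _ : ℝ ↦ (1 : ℝ)) x) = fun _ ↦ 0 := by
    funext x; simp
  rw [h1, zeroForm_zero, l2Inner_zero_left] at h
  -- `h : 0 = ⟪1, -φ⟫_{L²} = ∫_ℝ (-φ) vol`
  have h2 : MForm.l2Inner orient (zeroForm fun _ ↦ (1 : ℝ)) (zeroForm fun x ↦ -(φ : ℝ → ℝ) x) =
      MForm.integral orient (fun x ↦ (-(φ x)) • riemannianVolumeForm orient x) := by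
    unfold MForm.l2Inner
    congr 1
    funext x
    rw [inner_zeroForm, one_mul]
  have h3 : MForm.integral orient (fun x ↦ (-(φ x)) • riemannianVolumeForm orient x) =
      -MForm.integral orient (fun x ↦ φ x • riemannianVolumeForm orient x) := by
    rw [← neg_one_mul, ← MForm.integral_smul]
    congr 1
    funext x
    rw [Pi.smul_apply, smul_smul, neg_one_mul]
  rw [h2, h3, eq_comm, neg_eq_zero] at h
  exact integral_smul_vol_ne_zero φ.continuous φ.hasCompactSupport (fun x ↦ φ.nonneg) (x₀ := 0)
    (by rw [φ.one_of_mem_closedBall (Metric.mem_closedBall_self φ.rIn_pos.le)]; exact one_ne_zero) h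

end FlatLine

section UniversalClosure

attribute [local instance] FlatLine.factFinrank

-- names the `@[deprecated]` record `l2Inner_hodgeLaplacian_comm` on purpose (verdict clean-up 2026-08-15); REMOVE-WHEN the
-- record is deleted from `L2HodgeTheory.lean`
set_option linter.deprecated false in
/-- **`l2Inner_hodgeLaplacian_comm` cannot be discharged as stated**: its closure over manifolds
modelled on `𝓘(ℝ, ℝ)` in degrees `(0, 1)` is false (witness `FlatLine.not_l2Inner_hodgeLaplacian_comm_real`).
[folklore] -/
theorem not_forall_l2Inner_hodgeLaplacian_comm :
    ¬ ∀ (M : Type) [TopologicalSpace M] [ChartedSpace ℝ M] [T2Space M] [SigmaCompactSpace M]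
        [IsManifold 𝓘(ℝ, ℝ) ∞ M] [RiemannianBundle (fun x : M ↦ TangentSpace 𝓘(ℝ, ℝ) x)]
        (o : (x : M) → Orientation ℝ (TangentSpace 𝓘(ℝ, ℝ) x) (Fin 1)),
        l2Inner_hodgeLaplacian_comm (k := 0) (m := 1) o :=
  fun H ↦ FlatLine.not_l2Inner_hodgeLaplacian_comm_real (H ℝ FlatLine.orient)

end UniversalClosure

end Literature.NumberTheory.Transcendental
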